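import Mathlib
import Literature.Computability.Complexity.ExtMonotoneGRankSupport
import Summits.PneNP.PneNP.Theorems.LinAlgGateBlind.Negative.DetGate

/-!
# Route ConvexRankGates — crux `LinAlgGateBlind` (stmt-PneNP-10681), support:
# the determinantal normal form of GRANK gates, I — base change and generic compression

A GRANK gate (`IsGRankGate s g`, `Literature/Computability/Complexity/ExtMonotoneGates.lean`; the
inline `Lin` class of `Summit.PneNP.PneNP.Theses.ConvexRankGates.LinAlgGateBlind`) accepts `v` iff
the generic rank of `K₀ + ∑_{vᵢ = 1} Xᵢ Kᵢ` (`d × d` over ANY field `F`) is at least a threshold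
`θ`. `Theorems/LinAlgGateBlind/Negative/DetGate.lean` (standing disprover) shows that a
*determinant gate* — `θ = d`, i.e. "the affine symbolic matrix is generically non-singular" — is a
GRANK gate whose Boolean function is the monotone SHADOW of one polynomial (`detGate_isGRankGate`,
`detGate_eq_true_iff`). This file proves the CONVERSE, so that the two notions coincide:

* `le_rank_symbolicMatrix_map_iff` — **base change**: the gate function is unchanged when the data
  `K₀, Kᵢ` are pushed along any field embedding `F → F'` (generic rank is witnessed by a non-zero
  minor, and minors commute with coefficient maps); in particular WLOG `F` is algebraically closed
  (`exists_isAlgClosed_of_isGRankGate`).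
* `le_rank_symbolicMatrix_iff_det_compress_ne_zero` — **compression to a determinant**: with
  generic matrices `P ∈ F'^{θ×d}`, `Q ∈ F'^{d×θ}` whose entries are fresh indeterminates adjoined to
  the field (`F' = Frac F[p, q]`), `θ ≤ rank (K₀ + ∑ Xᵢ Kᵢ)|ᵥ` iff `det (P K₀ Q + ∑ Xᵢ P Kᵢ Q)|ᵥ ≠ 0`.
  Proof: `⇐` by `rank (P M Q) ≤ rank M` and base change; `⇒` by specialising `P, Q` to the 0/1
  selection matrices of a non-vanishing `θ × θ` minor (the specialisation is a ring map on
  `F[p, q][X]`, so it is performed before passing to fractions).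
* Sequel `ConvexRankGatesLinAlgGateBlindDetNormalForm.lean`: the normal form `GRANK_s = DET_s`
  (`isGRankGate_iff_det`), every GRANK gate is the monotone shadow of ONE determinant, and the crux
  `LinAlgGateBlind` restated verbatim with determinant gates (`linAlgGateBlind_iff_detBasis`).

All statements are def-free; the generic compression matrices are written out as
`Matrix.of fun i a => X (Sum.inl (i, a))` etc.

References: J. Edmonds, *Systems of distinct representatives and linear algebra*, J. Res. NBS 71B
(1967) §5 Thm. 1 and §7 (generic rank = largest non-vanishing minor) [Edmonds1967]; L. Lovász,
*Singular spaces of matrices and their application in combinatorics*, Bol. Soc. Bras. Mat. 20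
(1989) §1 (rank of a matrix space = rank of a generic element; compression by generic matrices).
-/

namespace Summit.PneNP.PneNP.Theorems

open Literature.Computability.Complexity MvPolynomial Matrix

/-! ### Base change: the gate function does not depend on the ambient field -/

section BaseChange

variable {F F' : Type*} [Field F] [Field F'] {n d : ℕ}

/-- Killing the unselected variables commutes with any change of coefficients. [folklore] -/
theorem map_killVars (f : F →+* F') (v : Fin n → Bool) (p : MvPolynomial (Fin n) F) :
    MvPolynomial.map f (killVars v p) = killVars v (MvPolynomial.map f p) := by
  have h : (MvPolynomial.map f).comp (killVars (F := F) v : MvPolynomial (Fin n) F →+*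
      MvPolynomial (Fin n) F) = (killVars (F := F') v : MvPolynomial (Fin n) F' →+*
      MvPolynomial (Fin n) F').comp (MvPolynomial.map f) := by
    refine MvPolynomial.ringHom_ext (fun a => ?_) (fun i => ?_)
    · simp [killVars]
    · simp only [RingHom.coe_comp, RingHom.coe_coe, Function.comp_apply, killVars_X, map_X]
      split_ifs <;> simp
  exact RingHom.congr_fun h p

/-- Killing variables is multiplicative on (rectangular) polynomial matrices. [folklore] -/
theorem map_killVars_mul {l m o : Type*} [Fintype m] (v : Fin n → Bool)
    (X₁ : Matrix l m (MvPolynomial (Fin n) F)) (X₂ : Matrix m o (MvPolynomial (Fin n) F)) :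
    (X₁ * X₂).map (killVars v) = X₁.map (killVars v) * X₂.map (killVars v) :=
  Matrix.map_mul (f := (killVars (F := F) v : MvPolynomial (Fin n) F →+* MvPolynomial (Fin n) F))

/-- The generic symbolic matrix commutes with any change of coefficients. [folklore] -/
theorem symbolicPolyMatrix_map (f : F →+* F') (K₀ : Matrix (Fin d) (Fin d) F)
    (K : Fin n → Matrix (Fin d) (Fin d) F) :
    (symbolicPolyMatrix K₀ K).map (MvPolynomial.map f) =
      symbolicPolyMatrix (K₀.map f) (fun i => (K i).map f) := by
  ext a b
  simp [symbolicPolyMatrix, Matrix.map_apply, Matrix.add_apply, Matrix.sum_apply, Matrix.smul_apply,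
    map_X, map_C]

/-- A killed minor of the generic symbolic matrix vanishes iff it vanishes after any (injective)
change of coefficients along a field map. [folklore] -/
theorem killVars_det_submatrix_map_eq_zero_iff (f : F →+* F') (K₀ : Matrix (Fin d) (Fin d) F)
    (K : Fin n → Matrix (Fin d) (Fin d) F) (v : Fin n → Bool) {ι : Type*} [Fintype ι]
    [DecidableEq ι] (r c : ι → Fin d) :
    killVars v ((symbolicPolyMatrix (K₀.map f) (fun i => (K i).map f)).submatrix r c).det = 0 ↔
      killVars v ((symbolicPolyMatrix K₀ K).submatrix r c).det = 0 := by
  rw [← symbolicPolyMatrix_map, Matrix.submatrix_map, ← RingHom.mapMatrix_apply, ← RingHom.map_det,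
    ← map_killVars, map_eq_zero_iff _ (MvPolynomial.map_injective f f.injective)]

/-- **Base change.** The generic rank threshold of a GRANK gate is unchanged when its data are
pushed along a field embedding `f : F → F'`: `θ ≤ rank (f K₀ + ∑_{vᵢ=1} Xᵢ f Kᵢ)` over `Frac F'[X]`
iff `θ ≤ rank (K₀ + ∑_{vᵢ=1} Xᵢ Kᵢ)` over `Frac F[X]` (rank is witnessed by a non-zero minor, and
minors commute with `f`). [cite: Edmonds1967, §5 Thm. 1 and §7] -/
theorem le_rank_symbolicMatrix_map_iff (f : F →+* F') (K₀ : Matrix (Fin d) (Fin d) F)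
    (K : Fin n → Matrix (Fin d) (Fin d) F) (v : Fin n → Bool) (θ : ℕ) :
    θ ≤ (symbolicMatrix (K₀.map f) (fun i => (K i).map f) v).rank ↔
      θ ≤ (symbolicMatrix K₀ K v).rank := by
  rw [Literature.LinearAlgebra.Matrix.le_rank_iff_exists_det_submatrix_ne_zero,
    Literature.LinearAlgebra.Matrix.le_rank_iff_exists_det_submatrix_ne_zero]
  refine exists_congr fun r => exists_congr fun c => ?_
  rw [Ne, det_submatrix_symbolicMatrix_eq_zero_iff, killVars_det_submatrix_map_eq_zero_iff, Ne,
    det_submatrix_symbolicMatrix_eq_zero_iff]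

end BaseChange

/-- **WLOG the field of a GRANK gate is algebraically closed** (push the data into an algebraic
closure; the gate function is unchanged by `le_rank_symbolicMatrix_map_iff`). [folklore] -/
theorem exists_isAlgClosed_of_isGRankGate : ∀ {s : ℕ} {g : GateFn}, IsGRankGate s g →
    ∃ (F : Type) (_ : Field F) (_ : IsAlgClosed F) (d θ : ℕ), d ≤ s ∧
      ∃ (K₀ : Matrix (Fin d) (Fin d) F) (K : Fin g.1 → Matrix (Fin d) (Fin d) F),
        ∀ v : Fin g.1 → Bool, g.2 v = true ↔ θ ≤ (symbolicMatrix K₀ K v).rank := by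
  intro s g h
  obtain ⟨F, _, d, θ, hd, K₀, K, hg⟩ := h
  refine ⟨AlgebraicClosure F, inferInstance, inferInstance, d, θ, hd,
    K₀.map (algebraMap F (AlgebraicClosure F)),
    fun i => (K i).map (algebraMap F (AlgebraicClosure F)), fun v => ?_⟩
  rw [hg v, le_rank_symbolicMatrix_map_iff]

/-! ### Compression of a rank threshold to a determinant by generic matrices -/

section Selection

variable {R : Type*} [CommRing R] {d θ : ℕ}

/-- Multiplying by 0/1 selection matrices extracts a submatrix:
`Sel(r) · M · Sel(c)ᵀ = M[r, c]`. [folklore] -/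
theorem sel_mul_mul_sel (M : Matrix (Fin d) (Fin d) R) (r c : Fin θ → Fin d) :
    (Matrix.of fun (i : Fin θ) (a : Fin d) => if a = r i then (1 : R) else 0) * M *
      (Matrix.of fun (b : Fin d) (j : Fin θ) => if b = c j then (1 : R) else 0) =
        M.submatrix r c := by
  ext i j
  simp [Matrix.mul_apply, ite_mul, mul_ite, Finset.sum_ite_eq']

end Selection

section Compress

variable {F : Type*} [Field F] {n d θ : ℕ}

/-- The ring map `F[p, q][X] → F[X]` specialising the parameters at a point `e` fixes (the image
of) every polynomial with coefficients in `F`. [folklore] -/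
theorem map_aeval_map_algebraMap {ι : Type*} (e : ι → F) (p : MvPolynomial (Fin n) F) :
    MvPolynomial.map (MvPolynomial.aeval e : MvPolynomial ι F →ₐ[F] F).toRingHom
      (MvPolynomial.map (algebraMap F (MvPolynomial ι F)) p) = p := by
  rw [MvPolynomial.map_map]
  have : (MvPolynomial.aeval e : MvPolynomial ι F →ₐ[F] F).toRingHom.comp
      (algebraMap F (MvPolynomial ι F)) = RingHom.id F := by
    ext a
    simp
  rw [this, MvPolynomial.map_id]

/-- **Specialisation of the generic compression.** Over the parameter ring `A = F[p, q]`
(`p` indexed by `Fin θ × Fin d`, `q` by `Fin d × Fin θ`): if `P = (p_{ia})`, `Q = (q_{bj})` are the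
generic matrices and `M` has coefficients in `F`, then specialising `p, q` to the selection
matrices of rows `r` and columns `c` sends `det (P M Q)` to the minor `det M[r, c]`. Hence a
non-zero minor forces `det (P M Q) ≠ 0` in `A[X]`. [folklore] -/
theorem det_generic_compress_ne_zero (M : Matrix (Fin d) (Fin d) (MvPolynomial (Fin n) F))
    (r c : Fin θ → Fin d) (hM : (M.submatrix r c).det ≠ 0) :
    ((Matrix.of fun (i : Fin θ) (a : Fin d) =>
        (C (X (Sum.inl (i, a))) : MvPolynomial (Fin n)
          (MvPolynomial ((Fin θ × Fin d) ⊕ (Fin d × Fin θ)) F))) *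
      M.map (MvPolynomial.map (algebraMap F
        (MvPolynomial ((Fin θ × Fin d) ⊕ (Fin d × Fin θ)) F))) *
      (Matrix.of fun (b : Fin d) (j : Fin θ) =>
        (C (X (Sum.inr (b, j))) : MvPolynomial (Fin n)
          (MvPolynomial ((Fin θ × Fin d) ⊕ (Fin d × Fin θ)) F)))).det ≠ 0 := by
  classical
  -- the specialisation point: `p ↦ Sel(r)`, `q ↦ Sel(c)ᵀ`
  let e : (Fin θ × Fin d) ⊕ (Fin d × Fin θ) → F :=
    Sum.elim (fun ia => if ia.2 = r ia.1 then 1 else 0) (fun bj => if bj.1 = c bj.2 then 1 else 0)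
  let E : MvPolynomial (Fin n) (MvPolynomial ((Fin θ × Fin d) ⊕ (Fin d × Fin θ)) F) →+*
      MvPolynomial (Fin n) F :=
    MvPolynomial.map (MvPolynomial.aeval e : MvPolynomial _ F →ₐ[F] F).toRingHom
  intro h0
  apply hM
  have h1 := congrArg E h0
  rw [map_zero, RingHom.map_det, RingHom.mapMatrix_apply, Matrix.map_mul, Matrix.map_mul,
    Matrix.map_map] at h1
  -- the three specialised factors
  have hP : (Matrix.of fun (i : Fin θ) (a : Fin d) =>
      (C (X (Sum.inl (i, a))) : MvPolynomial (Fin n)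
        (MvPolynomial ((Fin θ × Fin d) ⊕ (Fin d × Fin θ)) F))).map E =
      Matrix.of fun (i : Fin θ) (a : Fin d) =>
        if a = r i then (1 : MvPolynomial (Fin n) F) else 0 := by
    ext i a
    simp only [Matrix.map_apply, Matrix.of_apply, E, MvPolynomial.map_C, AlgHom.toRingHom_eq_coe,
      RingHom.coe_coe, MvPolynomial.aeval_X, e, Sum.elim_inl]
    split_ifs <;> simp
  have hQ : (Matrix.of fun (b : Fin d) (j : Fin θ) =>
      (C (X (Sum.inr (b, j))) : MvPolynomial (Fin n)
        (MvPolynomial ((Fin θ × Fin d) ⊕ (Fin d × Fin θ)) F))).map E =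
      Matrix.of fun (b : Fin d) (j : Fin θ) =>
        if b = c j then (1 : MvPolynomial (Fin n) F) else 0 := by
    ext b j
    simp only [Matrix.map_apply, Matrix.of_apply, E, MvPolynomial.map_C, AlgHom.toRingHom_eq_coe,
      RingHom.coe_coe, MvPolynomial.aeval_X, e, Sum.elim_inr]
    split_ifs <;> simp
  have hMid : (M.map (E ∘ MvPolynomial.map (algebraMap F
      (MvPolynomial ((Fin θ × Fin d) ⊕ (Fin d × Fin θ)) F)))) = M := by
    refine Matrix.ext fun a b => ?_
    simp only [Matrix.map_apply, Function.comp_apply, E]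
    exact map_aeval_map_algebraMap e (M a b)
  rw [hP, hQ, hMid, sel_mul_mul_sel] at h1
  exact h1

/-- Over a field: if `det (P M Q) ≠ 0` for `θ × d` and `d × θ` matrices `P, Q`, then `θ ≤ rank M`.
[folklore] -/
theorem le_rank_of_det_mul_mul_ne_zero {L : Type*} [Field L] (P : Matrix (Fin θ) (Fin d) L)
    (M : Matrix (Fin d) (Fin d) L) (Q : Matrix (Fin d) (Fin θ) L) (h : (P * M * Q).det ≠ 0) :
    θ ≤ M.rank := by
  have h1 : θ ≤ (P * M * Q).rank :=
    (Summit.PneNP.PneNP.Theorems.LinAlgGateBlind.Negative.le_rank_iff_det_ne_zero _).2 h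
  exact h1.trans ((Matrix.rank_mul_le_left _ _).trans (Matrix.rank_mul_le_right _ _))

/-- Conjugating the data by constant matrices conjugates the generic symbolic matrix:
`(P K₀ Q) + ∑ Xᵢ (P Kᵢ Q) = P (K₀ + ∑ Xᵢ Kᵢ) Q`. [folklore] -/
theorem symbolicPolyMatrix_mul_mul {L : Type*} [Field L] (P : Matrix (Fin θ) (Fin d) L)
    (Q : Matrix (Fin d) (Fin θ) L) (L₀ : Matrix (Fin d) (Fin d) L)
    (Lm : Fin n → Matrix (Fin d) (Fin d) L) :
    symbolicPolyMatrix (P * L₀ * Q) (fun i => P * Lm i * Q) =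
      P.map (C : L →+* MvPolynomial (Fin n) L) * symbolicPolyMatrix L₀ Lm *
        Q.map (C : L →+* MvPolynomial (Fin n) L) := by
  simp only [symbolicPolyMatrix, Matrix.map_mul, Matrix.mul_add, Matrix.add_mul, Matrix.mul_sum,
    Matrix.sum_mul, Matrix.mul_smul, Matrix.smul_mul]

/-- **Compression to a determinant.** For GRANK data `K₀, Kᵢ ∈ F^{d×d}` and a threshold `θ`, let
`F' = Frac F[p, q]` with fresh indeterminates `p_{ia}` (`i < θ`, `a < d`) and `q_{bj}`, and let
`P = (p_{ia}) ∈ F'^{θ×d}`, `Q = (q_{bj}) ∈ F'^{d×θ}`. Then for every input `v`: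
`θ ≤ rank (K₀ + ∑_{vᵢ=1} Xᵢ Kᵢ)` over `Frac F[X]` iff the `θ × θ` affine symbolic matrix with data
`P K₀ Q, P Kᵢ Q` is generically NON-SINGULAR at `v` over `Frac F'[X]`. (`⇒`: specialise `P, Q` to
selection matrices of a non-zero minor; `⇐`: `rank (P M Q) ≤ rank M` and base change.)
[cite: Edmonds1967, §5 Thm. 1 and §7] -/
theorem le_rank_symbolicMatrix_iff_det_compress_ne_zero {F : Type} [Field F]
    (K₀ : Matrix (Fin d) (Fin d) F) (K : Fin n → Matrix (Fin d) (Fin d) F) (θ : ℕ)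
    (v : Fin n → Bool) :
    θ ≤ (symbolicMatrix K₀ K v).rank ↔
      (symbolicMatrix
        ((Matrix.of fun (i : Fin θ) (a : Fin d) =>
            algebraMap (MvPolynomial ((Fin θ × Fin d) ⊕ (Fin d × Fin θ)) F)
              (FractionRing (MvPolynomial ((Fin θ × Fin d) ⊕ (Fin d × Fin θ)) F))
              (X (Sum.inl (i, a)))) *
          K₀.map ((algebraMap (MvPolynomial ((Fin θ × Fin d) ⊕ (Fin d × Fin θ)) F)
              (FractionRing (MvPolynomial ((Fin θ × Fin d) ⊕ (Fin d × Fin θ)) F))).comp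
            (algebraMap F (MvPolynomial ((Fin θ × Fin d) ⊕ (Fin d × Fin θ)) F))) *
          (Matrix.of fun (b : Fin d) (j : Fin θ) =>
            algebraMap (MvPolynomial ((Fin θ × Fin d) ⊕ (Fin d × Fin θ)) F)
              (FractionRing (MvPolynomial ((Fin θ × Fin d) ⊕ (Fin d × Fin θ)) F))
              (X (Sum.inr (b, j)))))
        (fun i =>
          (Matrix.of fun (i : Fin θ) (a : Fin d) =>
            algebraMap (MvPolynomial ((Fin θ × Fin d) ⊕ (Fin d × Fin θ)) F)
              (FractionRing (MvPolynomial ((Fin θ × Fin d) ⊕ (Fin d × Fin θ)) F))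
              (X (Sum.inl (i, a)))) *
          (K i).map ((algebraMap (MvPolynomial ((Fin θ × Fin d) ⊕ (Fin d × Fin θ)) F)
              (FractionRing (MvPolynomial ((Fin θ × Fin d) ⊕ (Fin d × Fin θ)) F))).comp
            (algebraMap F (MvPolynomial ((Fin θ × Fin d) ⊕ (Fin d × Fin θ)) F))) *
          (Matrix.of fun (b : Fin d) (j : Fin θ) =>
            algebraMap (MvPolynomial ((Fin θ × Fin d) ⊕ (Fin d × Fin θ)) F)
              (FractionRing (MvPolynomial ((Fin θ × Fin d) ⊕ (Fin d × Fin θ)) F))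
              (X (Sum.inr (b, j)))))
        v).det ≠ 0 := by
  classical
  -- names for the pieces of the statement
  set A := MvPolynomial ((Fin θ × Fin d) ⊕ (Fin d × Fin θ)) F with hA
  set j : A →+* FractionRing A := algebraMap A (FractionRing A) with hj
  set φ : F →+* FractionRing A := j.comp (algebraMap F A) with hφ
  set P : Matrix (Fin θ) (Fin d) (FractionRing A) :=
    Matrix.of fun (i : Fin θ) (a : Fin d) => j (X (Sum.inl (i, a))) with hP
  set Q : Matrix (Fin d) (Fin θ) (FractionRing A) :=
    Matrix.of fun (b : Fin d) (j' : Fin θ) => j (X (Sum.inr (b, j'))) with hQ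
  -- the polynomial-level compression over `A[X]`
  set PA : Matrix (Fin θ) (Fin d) (MvPolynomial (Fin n) A) :=
    Matrix.of fun (i : Fin θ) (a : Fin d) => C (X (Sum.inl (i, a))) with hPA
  set QA : Matrix (Fin d) (Fin θ) (MvPolynomial (Fin n) A) :=
    Matrix.of fun (b : Fin d) (j' : Fin θ) => C (X (Sum.inr (b, j'))) with hQA
  set M : Matrix (Fin d) (Fin d) (MvPolynomial (Fin n) F) :=
    (symbolicPolyMatrix K₀ K).map (killVars v) with hM
  have hjinj : Function.Injective j := IsFractionRing.injective A (FractionRing A)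
  -- the determinant of the compressed gate, pulled back to `A[X]`
  have hdet : (symbolicMatrix (P * K₀.map φ * Q) (fun i => P * (K i).map φ * Q) v).det = 0 ↔
      (PA * M.map (MvPolynomial.map (algebraMap F A)) * QA).det = 0 := by
    rw [← Matrix.submatrix_id_id (symbolicMatrix _ _ v), det_submatrix_symbolicMatrix_eq_zero_iff,
      Matrix.submatrix_id_id, symbolicPolyMatrix_mul_mul, ← symbolicPolyMatrix_map, AlgHom.map_det,
      AlgHom.mapMatrix_apply, map_killVars_mul, map_killVars_mul, Matrix.map_map, Matrix.map_map,
      Matrix.map_map]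
    -- `killVars` fixes the constant matrices, `killVars ∘ map φ = map j ∘ map (F → A) ∘ killVars`
    have hPj : P.map (⇑(killVars (F := FractionRing A) v) ∘
        ⇑(C : FractionRing A →+* MvPolynomial (Fin n) (FractionRing A))) =
        PA.map (MvPolynomial.map j) := by
      ext i a
      simp [hP, hPA, killVars, MvPolynomial.map_C]
    have hQj : Q.map (⇑(killVars (F := FractionRing A) v) ∘
        ⇑(C : FractionRing A →+* MvPolynomial (Fin n) (FractionRing A))) =
        QA.map (MvPolynomial.map j) := by
      ext b j'
      simp [hQ, hQA, killVars, MvPolynomial.map_C]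
    have hcomm : (symbolicPolyMatrix K₀ K).map
        (⇑(killVars (F := FractionRing A) v) ∘ ⇑(MvPolynomial.map φ)) =
        (M.map (MvPolynomial.map (algebraMap F A))).map (MvPolynomial.map j) := by
      refine Matrix.ext fun a b => ?_
      simp only [Matrix.map_apply, Function.comp_apply, hM]
      rw [← map_killVars, hφ, ← MvPolynomial.map_map]
    rw [hPj, hQj, hcomm, ← Matrix.map_mul, ← Matrix.map_mul, ← RingHom.mapMatrix_apply,
      ← RingHom.map_det, map_eq_zero_iff _ (MvPolynomial.map_injective j hjinj)]
  -- the compressed symbolic matrix is `P'' * (base change of the original) * Q''` over `Frac F'[X]`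
  have hfac : symbolicMatrix (P * K₀.map φ * Q) (fun i => P * (K i).map φ * Q) v =
      P.map (algebraMap (FractionRing A) (FractionRing (MvPolynomial (Fin n) (FractionRing A)))) *
        symbolicMatrix (K₀.map φ) (fun i => (K i).map φ) v *
        Q.map (algebraMap (FractionRing A) (FractionRing (MvPolynomial (Fin n) (FractionRing A)))) := by
    have hP' : ((P.map (C : FractionRing A →+* MvPolynomial (Fin n) (FractionRing A))).map
        (killVars v)).map (algebraMap (MvPolynomial (Fin n) (FractionRing A))
          (FractionRing (MvPolynomial (Fin n) (FractionRing A)))) =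
        P.map (algebraMap (FractionRing A) (FractionRing (MvPolynomial (Fin n) (FractionRing A)))) := by
      ext i a
      simp [killVars, IsScalarTower.algebraMap_apply (FractionRing A)
        (MvPolynomial (Fin n) (FractionRing A)) (FractionRing (MvPolynomial (Fin n) (FractionRing A)))]
    have hQ' : ((Q.map (C : FractionRing A →+* MvPolynomial (Fin n) (FractionRing A))).map
        (killVars v)).map (algebraMap (MvPolynomial (Fin n) (FractionRing A))
          (FractionRing (MvPolynomial (Fin n) (FractionRing A)))) =
        Q.map (algebraMap (FractionRing A) (FractionRing (MvPolynomial (Fin n) (FractionRing A)))) := by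
      ext b j'
      simp [killVars, IsScalarTower.algebraMap_apply (FractionRing A)
        (MvPolynomial (Fin n) (FractionRing A)) (FractionRing (MvPolynomial (Fin n) (FractionRing A)))]
    rw [symbolicMatrix_eq_map, symbolicMatrix_eq_map, symbolicPolyMatrix_mul_mul, map_killVars_mul,
      map_killVars_mul, Matrix.map_mul, Matrix.map_mul, hP', hQ']
  constructor
  · -- `⇒`: a non-zero `θ × θ` minor survives the generic compression
    intro hθ h0
    obtain ⟨r, c, hrc⟩ :=
      (Literature.LinearAlgebra.Matrix.le_rank_iff_exists_det_submatrix_ne_zero _).1 hθ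
    rw [Ne, det_submatrix_symbolicMatrix_eq_zero_iff] at hrc
    have hrc' : (M.submatrix r c).det ≠ 0 := by
      rwa [hM, Matrix.submatrix_map, ← AlgHom.mapMatrix_apply, ← AlgHom.map_det]
    exact det_generic_compress_ne_zero M r c hrc' (hdet.1 h0)
  · -- `⇐`: `rank (P M Q) ≤ rank M`, and the rank of `M` does not grow under base change
    intro hne
    have hne' : (P.map (algebraMap (FractionRing A)
          (FractionRing (MvPolynomial (Fin n) (FractionRing A)))) *
        symbolicMatrix (K₀.map φ) (fun i => (K i).map φ) v *
        Q.map (algebraMap (FractionRing A)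
          (FractionRing (MvPolynomial (Fin n) (FractionRing A))))).det ≠ 0 := by
      rwa [← hfac]
    have hθ' := le_rank_of_det_mul_mul_ne_zero _ _ _ hne'
    rwa [le_rank_symbolicMatrix_map_iff] at hθ'

end Compress

end Summit.PneNP.PneNP.Theorems
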